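import Mathlib
import Summits.CriticalPhenomena.SAWScalingLimit.Theorems.SAWDefectDecoherenceTipMartingaleDefs
import Literature.Probability.RandomPlanarGeometry.HexParafermionProofs
import HarnessLib

/-!
# First-entrance surgery of mid-edge self-avoiding walks
(helper `tm_first_entrance_split` for the stub `stub_telescopingRecursion` of the line
`tip-martingale-depth-induction`, crux `DefectDecoherence`, stmt-CriticalPhenomena-8549)

FIRST-ENTRANCE RENEWAL of the walks `HexMidEdgeSAW Λ s(u,w) s(v,t)` (`u ∉ Λ`, `w` outside
`B(v,ρ)`, `t` inside): each splits uniquely at its first vertex within `ρ` of `c_v` into a prefix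
with `IsPrefix v ρ y z π` and a walk of the SLIT DOMAIN `Λ ∖ π.verts` (`cutW`, `restW`, `glueW`;
re-summation identity `tm_first_entrance_split`).  NOT here: weights, windings (`…TmStarSums`).
Sources: H. Duminil-Copin, S. Smirnov, *The connective constant of the honeycomb lattice equals
`√(2+√2)`*, Ann. of Math. 175 (2012) (arXiv:1007.0575), §1–§2 (walks between mid-edges, windings,
Definition 1); the line card `Lines/tip-martingale-depth-induction.md` of the crux.
-/

noncomputable section

open scoped BigOperators ComplexConjugate Classical
open Literature.Probability.LatticeModels Literature.Probability.RandomPlanarGeometry.SAW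

namespace Summit.CriticalPhenomena.SAWScalingLimit.Theorems.DefectDecoherence.TipMartingale

/-! ### Edge lists -/

/-- The consecutive pairs of a concatenation of two nonempty lists. [folklore] -/
theorem edges_append : ∀ (l₁ l₂ : List HexVertex) (h₁ : l₁ ≠ []) (h₂ : l₂ ≠ []),
    List.zipWith (fun u w => s(u, w)) (l₁ ++ l₂) (l₁ ++ l₂).tail =
      List.zipWith (fun u w => s(u, w)) l₁ l₁.tail ++
        s(l₁.getLast h₁, l₂.head h₂) :: List.zipWith (fun u w => s(u, w)) l₂ l₂.tail
  | [], _, h₁, _ => (h₁ rfl).elim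
  | _, [], _, h₂ => (h₂ rfl).elim
  | [x], z :: l₂, _, _ => rfl
  | x :: x' :: l₁, z :: l₂, _, h₂ => by
    have ih := edges_append (x' :: l₁) (z :: l₂) (List.cons_ne_nil _ _) h₂
    simp only [List.cons_append, edges_cons_cons] at ih ⊢
    rw [ih]
    rfl

/-! ### Cutting a walk at its first entrance into `B(v,ρ)` and gluing back -/

section Surgery

variable {D : Finset HexVertex} {a b : Sym2 HexVertex} {v : HexVertex} {ρ : ℝ}

/-- The Boolean test "`q` lies outside `B(v,ρ)`". [folklore] -/
def outB (v : HexVertex) (ρ : ℝ) (q : HexVertex) : Bool := decide (ρ < dist (hexCenter q) (hexCenter v))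

/-- The vertices of a walk before its first entrance into `B(v,ρ)`. [folklore] -/
def preV (v : HexVertex) (ρ : ℝ) (ω : HexMidEdgeSAW D a b) : List HexVertex :=
  ω.verts.takeWhile (outB v ρ)

/-- The vertices of a walk from its first entrance into `B(v,ρ)` on. [folklore] -/
def sufV (v : HexVertex) (ρ : ℝ) (ω : HexMidEdgeSAW D a b) : List HexVertex :=
  ω.verts.dropWhile (outB v ρ)

/-- `preV ++ sufV = verts`. [folklore] -/
theorem preV_append_sufV (ω : HexMidEdgeSAW D a b) : preV v ρ ω ++ sufV v ρ ω = ω.verts :=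
  List.takeWhile_append_dropWhile

/-- The vertices before the first entrance lie outside the ball. [folklore] -/
theorem lt_dist_of_mem_preV {ω : HexMidEdgeSAW D a b} {q : HexVertex} (hq : q ∈ preV v ρ ω) :
    ρ < dist (hexCenter q) (hexCenter v) := by
  simpa [outB] using List.mem_takeWhile_imp hq

/-- The first entrance vertex lies in the ball. [folklore] -/
theorem dist_head_sufV_le {ω : HexMidEdgeSAW D a b} (hU : sufV v ρ ω ≠ []) :
    dist (hexCenter ((sufV v ρ ω).head hU)) (hexCenter v) ≤ ρ := by
  simpa [outB, sufV] using List.head_dropWhile_not (outB v ρ) (l := ω.verts) hU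

/-- **The first-entrance prefix** of a walk into `B(v,ρ)`, a walk to the entrance mid-edge.
[folklore] -/
def cutW (ω : HexMidEdgeSAW D a b) (hT : preV v ρ ω ≠ []) (hU : sufV v ρ ω ≠ []) :
    HexMidEdgeSAW D a s((preV v ρ ω).getLast hT, (sufV v ρ ω).head hU) where
  verts := preV v ρ ω
  subset x hx := ω.subset x ((List.takeWhile_sublist _).subset hx)
  nodup := ω.nodup.sublist (List.takeWhile_sublist _)
  isChain := by
    have h := ω.isChain
    rw [← preV_append_sufV (v := v) (ρ := ρ) ω] at h
    exact h.left_of_append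
  head_mem x hx := by
    apply ω.head_mem
    rw [← preV_append_sufV (v := v) (ρ := ρ) ω, List.head?_append, hx]
    rfl
  getLast_mem x hx := by
    rw [List.getLast?_eq_some_getLast hT, Option.some.injEq] at hx
    rw [← hx]; exact Sym2.mem_mk_left _ _
  eq_of_nil h := (hT h).elim
  edges_nodup _ := by
    have hN := ω.edges_nodup (by rw [← preV_append_sufV (v := v) (ρ := ρ) ω]; simp [hT])
    rw [← preV_append_sufV (v := v) (ρ := ρ) ω, edges_append _ _ hT hU] at hN
    have e : a :: (List.zipWith (fun u w => s(u, w)) (preV v ρ ω) (preV v ρ ω).tail ++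
        s((preV v ρ ω).getLast hT, (sufV v ρ ω).head hU) ::
          List.zipWith (fun u w => s(u, w)) (sufV v ρ ω) (sufV v ρ ω).tail) ++ [b] =
        (a :: List.zipWith (fun u w => s(u, w)) (preV v ρ ω) (preV v ρ ω).tail ++
          [s((preV v ρ ω).getLast hT, (sufV v ρ ω).head hU)]) ++
        (List.zipWith (fun u w => s(u, w)) (sufV v ρ ω) (sufV v ρ ω).tail ++ [b]) := by simp
    rw [e] at hN
    exact (List.nodup_append.1 hN).1
  fst_mem := ω.fst_mem

/-- Consecutive vertices across the cut are adjacent. [folklore] -/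
theorem adj_cut (ω : HexMidEdgeSAW D a b) (hT : preV v ρ ω ≠ []) (hU : sufV v ρ ω ≠ []) :
    hexGraph.Adj ((preV v ρ ω).getLast hT) ((sufV v ρ ω).head hU) := by
  have h := ω.isChain
  rw [← preV_append_sufV (v := v) (ρ := ρ) ω] at h
  exact h.rel_getLast_head_of_append hT hU

/-- **The continuation** after the first-entrance prefix, a walk of the slit domain. [folklore] -/
def restW (ω : HexMidEdgeSAW D a b) (hT : preV v ρ ω ≠ []) (hU : sufV v ρ ω ≠ []) :
    HexMidEdgeSAW (D \ (preV v ρ ω).toFinset) s((preV v ρ ω).getLast hT, (sufV v ρ ω).head hU)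
      b where
  verts := sufV v ρ ω
  subset x hx := by
    have hN := ω.nodup
    rw [← preV_append_sufV (v := v) (ρ := ρ) ω, List.nodup_append] at hN
    refine Finset.mem_sdiff.2 ⟨ω.subset x ((List.dropWhile_sublist _).subset hx), fun h => ?_⟩
    exact hN.2.2 x (List.mem_toFinset.1 h) x hx rfl
  nodup := ω.nodup.sublist (List.dropWhile_sublist _)
  isChain := by
    have h := ω.isChain
    rw [← preV_append_sufV (v := v) (ρ := ρ) ω] at h
    exact h.right_of_append
  head_mem x hx := by
    rw [List.head?_eq_some_head hU, Option.some.injEq] at hx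
    rw [← hx]; exact Sym2.mem_mk_right _ _
  getLast_mem x hx := by
    apply ω.getLast_mem
    rw [← preV_append_sufV (v := v) (ρ := ρ) ω, List.getLast?_append, hx]
    rfl
  eq_of_nil h := (hU h).elim
  edges_nodup _ := by
    have hN := ω.edges_nodup (by rw [← preV_append_sufV (v := v) (ρ := ρ) ω]; simp [hT])
    rw [← preV_append_sufV (v := v) (ρ := ρ) ω, edges_append _ _ hT hU] at hN
    have e : a :: (List.zipWith (fun u w => s(u, w)) (preV v ρ ω) (preV v ρ ω).tail ++
        s((preV v ρ ω).getLast hT, (sufV v ρ ω).head hU) ::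
          List.zipWith (fun u w => s(u, w)) (sufV v ρ ω) (sufV v ρ ω).tail) ++ [b] =
        (a :: List.zipWith (fun u w => s(u, w)) (preV v ρ ω) (preV v ρ ω).tail) ++
        (s((preV v ρ ω).getLast hT, (sufV v ρ ω).head hU) ::
          List.zipWith (fun u w => s(u, w)) (sufV v ρ ω) (sufV v ρ ω).tail ++ [b]) := by simp
    rw [e] at hN
    exact (List.nodup_append.1 hN).2.1
  fst_mem := ⟨(SimpleGraph.mem_edgeSet _).2 (adj_cut ω hT hU), _, Sym2.mem_mk_right _ _,
    by
      have hN := ω.nodup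
      rw [← preV_append_sufV (v := v) (ρ := ρ) ω, List.nodup_append] at hN
      refine Finset.mem_sdiff.2 ⟨ω.subset _ ((List.dropWhile_sublist _).subset
        (List.head_mem hU)), fun h => ?_⟩
      exact hN.2.2 _ (List.mem_toFinset.1 h) _ (List.head_mem hU) rfl⟩

/-- **Gluing** `π : a → s(y,z)` (ending at `y`) with a continuation of the slit domain `D ∖ π`
starting at `z ∼ y`: the concatenated walk of `D`. [folklore] -/
def glueW {y z : HexVertex} (π : HexMidEdgeSAW D a s(y, z))
    (ω : HexMidEdgeSAW (D \ π.verts.toFinset) s(y, z) b) (hy : π.verts.getLast? = some y)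
    (hz : ω.verts.head? = some z) (hyz : hexGraph.Adj y z) (hab : a ≠ b) :
    HexMidEdgeSAW D a b where
  verts := π.verts ++ ω.verts
  subset x hx := by
    rcases List.mem_append.1 hx with h | h
    · exact π.subset x h
    · exact (Finset.mem_sdiff.1 (ω.subset x h)).1
  nodup := List.nodup_append.2 ⟨π.nodup, ω.nodup, fun x hx x' hx' e =>
    (Finset.mem_sdiff.1 (ω.subset x' hx')).2 (List.mem_toFinset.2 (e ▸ hx))⟩
  isChain := List.IsChain.append π.isChain ω.isChain fun x hx x' hx' => by
    rw [hy] at hx; rw [hz] at hx'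
    cases hx; cases hx'; exact hyz
  head_mem x hx := by
    have hne : π.verts ≠ [] := by rintro h; simp [h] at hy
    apply π.head_mem
    rw [List.head?_append, List.head?_eq_some_head hne, Option.some_or] at hx
    rwa [List.head?_eq_some_head hne]
  getLast_mem x hx := by
    have hne : ω.verts ≠ [] := by rintro h; simp [h] at hz
    apply ω.getLast_mem
    rw [List.getLast?_append, List.getLast?_eq_some_getLast hne, Option.some_or] at hx
    rwa [List.getLast?_eq_some_getLast hne]
  eq_of_nil h := by
    have hne : π.verts ≠ [] := by rintro h; simp [h] at hy
    exact (hne (List.append_eq_nil_iff.1 h).1).elim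
  edges_nodup _ := by
    have hπne : π.verts ≠ [] := by rintro h; simp [h] at hy
    have hωne : ω.verts ≠ [] := by rintro h; simp [h] at hz
    have hy' : π.verts.getLast hπne = y :=
      Option.some_injective _ ((List.getLast?_eq_some_getLast hπne).symm.trans hy)
    have hz' : ω.verts.head hωne = z :=
      Option.some_injective _ ((List.head?_eq_some_head hωne).symm.trans hz)
    have hEπ := π.edges_nodup hπne
    have hEω := ω.edges_nodup hωne
    have hdis : ∀ x ∈ ω.verts, x ∉ π.verts := fun x hx h =>
      (Finset.mem_sdiff.1 (ω.subset x hx)).2 (List.mem_toFinset.2 h)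
    have hyπ : y ∈ π.verts := by have := List.getLast_mem hπne; rwa [hy'] at this
    have hha : π.verts.head hπne ∈ a := π.head_mem _ (List.head?_eq_some_head hπne)
    have hlb : ω.verts.getLast hωne ∈ b :=
      ω.getLast_mem _ (List.getLast?_eq_some_getLast hωne)
    rw [edges_append _ _ hπne hωne, hy', hz']
    have e : a :: (List.zipWith (fun u w => s(u, w)) π.verts π.verts.tail ++
        s(y, z) :: List.zipWith (fun u w => s(u, w)) ω.verts ω.verts.tail) ++ [b] =
        (a :: List.zipWith (fun u w => s(u, w)) π.verts π.verts.tail ++ [s(y, z)]) ++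
        (List.zipWith (fun u w => s(u, w)) ω.verts ω.verts.tail ++ [b]) := by simp
    rw [e, List.nodup_append]
    refine ⟨hEπ, (List.nodup_cons.1 hEω).2, fun x hx x' hx' hxx => ?_⟩
    subst hxx
    rcases List.mem_append.1 hx' with hx' | hx'
    · have hmem := forall_mem_of_mem_edges _ _ hx'
      rcases List.mem_cons.1 hx with hxa | hx
      · exact hdis _ (hmem _ (hxa ▸ hha)) (List.head_mem hπne)
      rcases List.mem_append.1 hx with hx | hx
      · obtain ⟨i, hi, rfl⟩ := mem_edges_iff.1 hx
        exact hdis _ (hmem _ (Sym2.mem_mk_left _ _)) (List.getElem_mem _)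
      · rw [List.mem_singleton] at hx
        exact hdis _ (hmem _ (hx ▸ Sym2.mem_mk_left y z)) hyπ
    · rw [List.mem_singleton] at hx'
      rcases List.mem_cons.1 hx with hxa | hx
      · exact hab (hxa.symm.trans hx')
      rcases List.mem_append.1 hx with hx | hx
      · have hmem := forall_mem_of_mem_edges _ _ hx
        exact hdis _ (List.getLast_mem hωne) (hmem _ (hx' ▸ hlb))
      · rw [List.mem_singleton] at hx
        exact (List.nodup_cons.1 hEω).1
          (List.mem_append_right _ (List.mem_singleton.2 (hx.symm.trans hx')))
  fst_mem := π.fst_mem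

end Surgery

/-! ### The first-entrance bijection as a sum identity -/

section Renewal

variable {D : Finset HexVertex} {a b : Sym2 HexVertex} {u w v t : HexVertex} {ρ : ℝ}

/-- Unfolding `IsPrefix`. [folklore] -/
theorem isPrefix_iff {r : ℝ} {y z : HexVertex} (γ : HexMidEdgeSAW D a s(y, z)) :
    IsPrefix v r y z γ ↔ γ.verts.getLast? = some y ∧ hexGraph.Adj y z ∧
      dist (hexCenter z) (hexCenter v) ≤ r ∧
        ∀ q ∈ γ.verts, r < dist (hexCenter q) (hexCenter v) := Iff.rfl

/-- A mid-edge with an endpoint outside `B(v,ρ)` is not a mid-edge at `v`'s star. [folklore] -/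
theorem mk_ne_mk_of_lt_dist {q : HexVertex} {e : Sym2 HexVertex}
    (hq : ρ < dist (hexCenter q) (hexCenter v)) (hqe : q ∈ e)
    (ht : dist (hexCenter t) (hexCenter v) ≤ ρ) (hρ : 0 ≤ ρ) : e ≠ s(v, t) := by
  intro h
  have hm : q ∈ s(v, t) := h ▸ hqe
  rcases Sym2.mem_iff.1 hm with rfl | rfl
  · rw [dist_self] at hq; exact absurd hq (not_lt.2 hρ)
  · exact absurd hq (not_lt.2 ht)

/-- Walks from `s(u,w)` (`u ∉ D`, `w` outside the ball) have nonempty prefixes. [folklore] -/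
theorem preV_ne_nil (hu : u ∉ D) (hw : ρ < dist (hexCenter w) (hexCenter v))
    (ht : dist (hexCenter t) (hexCenter v) ≤ ρ) (hρ : 0 ≤ ρ)
    (ω : HexMidEdgeSAW D s(u, w) s(v, t)) : preV v ρ ω ≠ [] := by
  have hne : ω.verts ≠ [] := fun h =>
    mk_ne_mk_of_lt_dist hw (Sym2.mem_mk_right _ _) ht hρ (ω.eq_of_nil h)
  obtain ⟨x, rest, hx⟩ := List.exists_cons_of_ne_nil hne
  have hxw : x = w := by
    have h := ω.head_mem x (by rw [hx]; rfl)
    rcases Sym2.mem_iff.1 h with rfl | rfl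
    · exact absurd (ω.subset x (by rw [hx]; exact List.mem_cons_self)) hu
    · rfl
  subst hxw
  rw [preV, hx, List.takeWhile_cons_of_pos (by simpa [outB] using hw)]
  exact List.cons_ne_nil _ _

/-- … and a nonempty continuation. [folklore] -/
theorem sufV_ne_nil (ht : dist (hexCenter t) (hexCenter v) ≤ ρ) (hρ : 0 ≤ ρ)
    (ω : HexMidEdgeSAW D a s(v, t)) (hne : ω.verts ≠ []) : sufV v ρ ω ≠ [] := by
  rw [sufV, Ne, List.dropWhile_eq_nil_iff]
  intro h
  have hl := ω.getLast_mem _ (List.getLast?_eq_some_getLast hne)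
  have hout := h _ (List.getLast_mem hne)
  simp only [outB, decide_eq_true_eq] at hout
  rcases Sym2.mem_iff.1 hl with e | e <;> rw [e] at hout
  · rw [dist_self] at hout; exact absurd hout (not_lt.2 hρ)
  · exact absurd hout (not_lt.2 ht)

/-- The continuation of a first-entrance prefix starts at the entrance vertex. [folklore] -/
theorem head_eq_of_isPrefix {y z : HexVertex} {π : HexMidEdgeSAW D a s(y, z)}
    (hP : IsPrefix v ρ y z π) (ht : dist (hexCenter t) (hexCenter v) ≤ ρ) (hρ : 0 ≤ ρ)
    (ω : HexMidEdgeSAW (D \ π.verts.toFinset) s(y, z) s(v, t)) : ω.verts.head? = some z := by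
  obtain ⟨hy, -, -, hout⟩ := (isPrefix_iff π).1 hP
  have hyπ : y ∈ π.verts := List.mem_of_getLast? hy
  have hne : ω.verts ≠ [] := fun h =>
    mk_ne_mk_of_lt_dist (hout y hyπ) (Sym2.mem_mk_left _ _) ht hρ (ω.eq_of_nil h)
  rw [List.head?_eq_some_head hne, Option.some.injEq]
  have hm := ω.head_mem _ (List.head?_eq_some_head hne)
  rcases Sym2.mem_iff.1 hm with e | e
  · have := (Finset.mem_sdiff.1 (ω.subset _ (List.head_mem hne))).2
    rw [e] at this
    exact absurd (List.mem_toFinset.2 hyπ) this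
  · exact e

/-- The prefix of a glued walk is the prefix. [folklore] -/
theorem preV_glueW {y z : HexVertex} {π : HexMidEdgeSAW D a s(y, z)}
    {ω : HexMidEdgeSAW (D \ π.verts.toFinset) s(y, z) b} (hP : IsPrefix v ρ y z π)
    (hz : ω.verts.head? = some z) (hab : a ≠ b) :
    preV v ρ (glueW π ω hP.1 hz hP.2.1 hab) = π.verts ∧
      sufV v ρ (glueW π ω hP.1 hz hP.2.1 hab) = ω.verts := by
  obtain ⟨-, -, hzle, hout⟩ := (isPrefix_iff π).1 hP
  have hne : ω.verts ≠ [] := by rintro h; simp [h] at hz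
  obtain ⟨x, rest, hx⟩ := List.exists_cons_of_ne_nil hne
  have hxz : x = z := by rw [hx] at hz; simpa using hz
  subst hxz
  have h1 : ∀ q ∈ π.verts, outB v ρ q = true := fun q hq => by simpa [outB] using hout q hq
  have h2 : ¬ (outB v ρ x = true) := by simpa [outB] using hzle
  refine ⟨?_, ?_⟩
  · show List.takeWhile (outB v ρ) (π.verts ++ ω.verts) = π.verts
    rw [List.takeWhile_append_of_pos h1, hx, List.takeWhile_cons_of_neg h2, List.append_nil]
  · show List.dropWhile (outB v ρ) (π.verts ++ ω.verts) = ω.verts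
    rw [List.dropWhile_append_of_pos h1, hx, List.dropWhile_cons_of_neg h2]

/-- Extensionality for the (dart, prefix, continuation) triples. [folklore] -/
theorem sigma_ext_verts
    {x x' : (p : HexVertex × HexVertex) × (π : HexMidEdgeSAW D a s(p.1, p.2)) ×
      HexMidEdgeSAW (D \ π.verts.toFinset) s(p.1, p.2) b}
    (h1 : x.1 = x'.1) (h2 : x.2.1.verts = x'.2.1.verts) (h3 : x.2.2.verts = x'.2.2.verts) :
    x = x' := by
  obtain ⟨p, π, ω⟩ := x
  obtain ⟨p', π', ω'⟩ := x'
  dsimp only at h1 h2 h3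
  subst h1
  obtain rfl : π = π' := HexMidEdgeSAW.ext h2
  obtain rfl : ω = ω' := HexMidEdgeSAW.ext h3
  rfl

/-- **First-entrance renewal (the bijection)**: every walk `s(u,w) → s(v,t)` of `D` (`u ∉ D`, `w`
outside `B(v,ρ)`, `t` inside) is uniquely (first-entrance prefix into `B(v,ρ)`) ++ (walk of the
slit domain); so functionals of the vertex list re-sum over (dart, prefix, continuation). [folklore] -/
theorem sum_walks_eq_sum_prefix (hu : u ∉ D) (hw : ρ < dist (hexCenter w) (hexCenter v))
    (ht : dist (hexCenter t) (hexCenter v) ≤ ρ) (hρ : 0 ≤ ρ) {M : Type*} [AddCommMonoid M]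
    (Ψ : List HexVertex → M) :
    ∑ ω : HexMidEdgeSAW D s(u, w) s(v, t), Ψ ω.verts =
      ∑ p ∈ D ×ˢ D, ∑ π : HexMidEdgeSAW D s(u, w) s(p.1, p.2),
        if IsPrefix v ρ p.1 p.2 π then
          ∑ ω' : HexMidEdgeSAW (D \ π.verts.toFinset) s(p.1, p.2) s(v, t),
            Ψ (π.verts ++ ω'.verts)
        else 0 := by
  have hab : s(u, w) ≠ s(v, t) := mk_ne_mk_of_lt_dist hw (Sym2.mem_mk_right _ _) ht hρ
  have hT := preV_ne_nil hu hw ht hρ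
  have hU : ∀ ω : HexMidEdgeSAW D s(u, w) s(v, t), sufV v ρ ω ≠ [] := fun ω =>
    sufV_ne_nil ht hρ ω fun h => hab (ω.eq_of_nil h)
  set T : Finset ((p : HexVertex × HexVertex) × (π : HexMidEdgeSAW D s(u, w) s(p.1, p.2)) ×
      HexMidEdgeSAW (D \ π.verts.toFinset) s(p.1, p.2) s(v, t)) :=
    (D ×ˢ D).sigma fun p =>
      (Finset.univ.filter fun π => IsPrefix v ρ p.1 p.2 π).sigma fun _ => Finset.univ with hTdef
  have hR : (∑ p ∈ D ×ˢ D, ∑ π : HexMidEdgeSAW D s(u, w) s(p.1, p.2),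
        if IsPrefix v ρ p.1 p.2 π then
          ∑ ω' : HexMidEdgeSAW (D \ π.verts.toFinset) s(p.1, p.2) s(v, t),
            Ψ (π.verts ++ ω'.verts)
        else 0) = ∑ x ∈ T, Ψ (x.2.1.verts ++ x.2.2.verts) := by
    rw [hTdef, Finset.sum_sigma]
    refine Finset.sum_congr rfl fun p _ => ?_
    rw [Finset.sum_sigma, Finset.sum_filter]
  rw [hR]
  have hmemT : ∀ {x}, x ∈ T ↔ x.1 ∈ D ×ˢ D ∧ IsPrefix v ρ x.1.1 x.1.2 x.2.1 := by
    intro x; simp [hTdef]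
  refine Finset.sum_bij'
    (fun ω _ => ⟨(_, _), cutW ω (hT ω) (hU ω), restW ω (hT ω) (hU ω)⟩)
    (fun x hx => glueW x.2.1 x.2.2 (hmemT.1 hx).2.1
      (head_eq_of_isPrefix (hmemT.1 hx).2 ht hρ x.2.2) (hmemT.1 hx).2.2.1 hab)
    (fun ω _ => ?_) (fun x hx => Finset.mem_univ _) (fun ω _ => ?_) (fun x hx => ?_)
    (fun ω _ => by simp only [cutW, restW, preV_append_sufV])
  · -- the cut lands in `T`
    refine hmemT.2 ⟨Finset.mem_product.2 ⟨?_, ?_⟩, (isPrefix_iff _).2 ⟨?_, adj_cut ω _ _,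
      dist_head_sufV_le _, fun q hq => lt_dist_of_mem_preV hq⟩⟩
    · exact ω.subset _ ((List.takeWhile_sublist _).subset (List.getLast_mem (hT ω)))
    · exact ω.subset _ ((List.dropWhile_sublist _).subset (List.head_mem (hU ω)))
    · exact List.getLast?_eq_some_getLast (hT ω)
  · exact HexMidEdgeSAW.ext (preV_append_sufV ω)
  · obtain ⟨hp, hP⟩ := hmemT.1 hx
    have hz := head_eq_of_isPrefix hP ht hρ x.2.2
    obtain ⟨e1, e2⟩ := preV_glueW (b := s(v, t)) hP hz hab
    refine sigma_ext_verts (Prod.ext ?_ ?_) e1 e2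
    · show (preV v ρ _).getLast _ = _
      apply Option.some_injective
      rw [← List.getLast?_eq_some_getLast, e1, hP.1]
    · show (sufV v ρ _).head _ = _
      apply Option.some_injective
      rw [← List.head?_eq_some_head, e2, hz]

end Renewal

/-- **Registered helper `tm_first_entrance_split`** (the first-entrance bijection as a sum
identity, complex-valued functionals). [folklore] -/
theorem tm_first_entrance_split : ∀ (D : Finset HexVertex) (u w v t : HexVertex) (ρ : ℝ),
    u ∉ D → ρ < dist (hexCenter w) (hexCenter v) → dist (hexCenter t) (hexCenter v) ≤ ρ → 0 ≤ ρ →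
    ∀ Ψ : List HexVertex → ℂ, ∑ ω : HexMidEdgeSAW D s(u, w) s(v, t), Ψ ω.verts =
      ∑ p ∈ D ×ˢ D, ∑ π : HexMidEdgeSAW D s(u, w) s(p.1, p.2),
        if IsPrefix v ρ p.1 p.2 π then
          ∑ ω' : HexMidEdgeSAW (D \ π.verts.toFinset) s(p.1, p.2) s(v, t),
            Ψ (π.verts ++ ω'.verts)
        else 0 :=
  fun _ _ _ _ _ _ hu hw ht hρ Ψ => sum_walks_eq_sum_prefix hu hw ht hρ Ψ

end Summit.CriticalPhenomena.SAWScalingLimit.Theorems.DefectDecoherence.TipMartingale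

end
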